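import Mathlib.Analysis.Matrix.Order
import Mathlib.NumberTheory.NumberField.CanonicalEmbedding.Basic
import HarnessLib

/-!
# Siegel-reduced families of Hermitian matrices (definitions)

Topic `NumberTheory/Automorphic`; namespace `Literature.NumberTheory.Automorphic`, grouping
sub-namespace `SiegelFamily`.  Definitions with bodies and their unfolding / monotonicity lemmas
only; Mathlib only.

Reduction theory of `GL_n` over a number field `K` in the cone model: `Γ ≤ GL_n(K)` acts on the
cone `X` of families `H = (H_w)_{w ∣ ∞}` of positive definite self-adjoint `n × n` matrices over
the archimedean completions (real symmetric at real places, complex Hermitian at complex places),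
and a Siegel set `𝔖 = ω A_t K_∞` of `GL_n(K ⊗ ℝ)` has image `𝔖 • 1 = {b bᴴ : b ∈ 𝔖}` described
by inequalities on the successive pivots and the unipotent coordinates of the Cholesky
decomposition `H_w = u_w Λ_w u_wᴴ` ([Borel1969, §1, §12–§13]; Siegel (1939/40) for the
positive-forms model; Humbert (1940) over number fields).  This file introduces that description in
a RECURSIVE form which peels off the last row and column through the Schur complement — the
form in which "the convex hull of a Siegel domain lies in a larger Siegel domain" is proved by
induction on `n` (file `SiegelReducedFamiliesHull`):

* `SiegelFamily.schur H` — for a family `H` of `(m+1) × (m+1)` matrices, the family of Schur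
  complements of the last diagonal entry, `H_w[<m,<m] − H_w[<m,m] H_w[m,<m] / H_w[m,m]`;
* `SiegelFamily.IsReduced c C τ m H` — `H = (H_w)` is `(c, C, τ)`-reduced: every `H_w` is
  Hermitian with last entry `a_w = H_w[m,m] > 0`, the `a_w` are comparable across the index set
  (`a_w < C a_{w'}`), the last column is small (`‖H_w[j,m]‖ < c a_w`), the last pivot is
  dominated by the next one (`a_w < τ · (schur H)_w[m-1,m-1]`), and `schur H` is reduced;
* `SiegelFamily.placeFamily K H` — the family of complex matrices attached to a matrix over
  Mathlib's `mixedSpace K = ℝ^{r₁} × ℂ^{r₂}` (real places read in `ℂ`), an injective continuous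
  `ℝ`-linear map used to pull the reduced families back to matrices over `K ⊗ ℝ`.

Design: strict inequalities (so that reducedness is an open condition); the index set `ι` is
arbitrary (the cross-index comparison is what the norm-one part `M(𝔸)¹` of an adelic Siegel set
imposes at the archimedean places); no positivity of `c, C, τ` is built in (monotonicity lemmas
are stated for all real parameters).  What is NOT here: the Hull Lemma, openness, positivity and
the comparison with adelic Siegel sets (sequel files).

## References

* A. Borel, *Introduction aux groupes arithmétiques*, Hermann (1969), §1 (Siegel sets of `GL_n(ℝ)`
  on positive forms), §12–§13 [Borel1969].
* A. Borel, *Ensembles fondamentaux pour les groupes arithmétiques*, Colloque sur la théorie des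
  groupes algébriques, Bruxelles (1962), §4.
-/

noncomputable section

open scoped ComplexOrder Matrix

namespace Literature.NumberTheory.Automorphic

namespace SiegelFamily

variable {ι : Type*}

/-! ### The Schur complement of the last pivot -/

/-- **Schur complement of the last diagonal entry, index by index**: for a family `H` of
`(m+1) × (m+1)` complex matrices, `schur H w = H_w[<m,<m] − H_w[<m, m] · H_w[m, <m] / H_w[m, m]`
(an `m × m` matrix).  No invertibility is assumed (`x / 0 = 0` in `ℂ`); it is used only when
`H_w[m,m] ≠ 0`. [folklore] -/
def schur {m : ℕ} (H : ι → Matrix (Fin (m + 1)) (Fin (m + 1)) ℂ) : ι → Matrix (Fin m) (Fin m) ℂ :=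
  fun w => Matrix.of fun i j => H w i.castSucc j.castSucc -
    H w i.castSucc (Fin.last m) * H w (Fin.last m) j.castSucc / H w (Fin.last m) (Fin.last m)

/-- Entries of the Schur complement family (definitional unfolding). [folklore] -/
@[simp]
theorem schur_apply {m : ℕ} (H : ι → Matrix (Fin (m + 1)) (Fin (m + 1)) ℂ) (w : ι) (i j : Fin m) :
    schur H w i j = H w i.castSucc j.castSucc -
      H w i.castSucc (Fin.last m) * H w (Fin.last m) j.castSucc / H w (Fin.last m) (Fin.last m) :=
  rfl

/-! ### Reduced families -/

/-- **`(c, C, τ)`-reduced families of Hermitian matrices** (recursive description of the image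
`𝔖 • 1` of an archimedean Siegel set in the cone of positive forms, peeling the last index): a
family of `0 × 0` matrices is reduced; a family `H` of `(m+1) × (m+1)` matrices is reduced iff
every `H_w` is Hermitian, the last entries `a_w = H_w[m,m]` are positive and pairwise comparable
(`a_w < C · a_{w'}`), the last column is small (`‖H_w[j,m]‖ < c · a_w`), the last pivot is
dominated by the next one (`a_w < τ · (schur H)_w[m-1,m-1]`, vacuous for `m = 0`), and the Schur
complement family `schur H` is reduced. [cite: Borel1969, §1 and §12–§13] -/
def IsReduced (c C τ : ℝ) : (m : ℕ) → (ι → Matrix (Fin m) (Fin m) ℂ) → Prop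
  | 0, _ => True
  | m + 1, H =>
      (∀ w, (H w).IsHermitian) ∧
      (∀ w, 0 < (H w (Fin.last m) (Fin.last m)).re) ∧
      (∀ w w', (H w (Fin.last m) (Fin.last m)).re < C * (H w' (Fin.last m) (Fin.last m)).re) ∧
      (∀ w (j : Fin m), ‖H w j.castSucc (Fin.last m)‖ < c * (H w (Fin.last m) (Fin.last m)).re) ∧
      (∀ w (j : Fin m), (j : ℕ) + 1 = m →
        (H w (Fin.last m) (Fin.last m)).re < τ * (schur H w j j).re) ∧
      IsReduced c C τ m (schur H)

/-- Every family of `0 × 0` matrices is reduced. [folklore] -/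
@[simp]
theorem isReduced_zero (c C τ : ℝ) (H : ι → Matrix (Fin 0) (Fin 0) ℂ) : IsReduced c C τ 0 H :=
  trivial

/-- Unfolding of reducedness in size `m + 1`. [folklore] -/
theorem isReduced_succ_iff (c C τ : ℝ) {m : ℕ} (H : ι → Matrix (Fin (m + 1)) (Fin (m + 1)) ℂ) :
    IsReduced c C τ (m + 1) H ↔
      (∀ w, (H w).IsHermitian) ∧
      (∀ w, 0 < (H w (Fin.last m) (Fin.last m)).re) ∧
      (∀ w w', (H w (Fin.last m) (Fin.last m)).re < C * (H w' (Fin.last m) (Fin.last m)).re) ∧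
      (∀ w (j : Fin m), ‖H w j.castSucc (Fin.last m)‖ < c * (H w (Fin.last m) (Fin.last m)).re) ∧
      (∀ w (j : Fin m), (j : ℕ) + 1 = m →
        (H w (Fin.last m) (Fin.last m)).re < τ * (schur H w j j).re) ∧
      IsReduced c C τ m (schur H) :=
  Iff.rfl

/-- A reduced family consists of Hermitian matrices. [folklore] -/
theorem IsReduced.isHermitian {c C τ : ℝ} :
    ∀ {m : ℕ} {H : ι → Matrix (Fin m) (Fin m) ℂ}, IsReduced c C τ m H → ∀ w, (H w).IsHermitian
  | 0, _, _, _ => Matrix.IsHermitian.ext fun i => Fin.elim0 i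
  | _ + 1, _, h, w => h.1 w

/-- The last diagonal entries of a reduced family of positive size are positive. [folklore] -/
theorem IsReduced.re_pos {c C τ : ℝ} {m : ℕ} {H : ι → Matrix (Fin (m + 1)) (Fin (m + 1)) ℂ}
    (h : IsReduced c C τ (m + 1) H) (w : ι) : 0 < (H w (Fin.last m) (Fin.last m)).re :=
  h.2.1 w

/-- The Schur complement family of a reduced family is reduced. [folklore] -/
theorem IsReduced.schur {c C τ : ℝ} {m : ℕ} {H : ι → Matrix (Fin (m + 1)) (Fin (m + 1)) ℂ}
    (h : IsReduced c C τ (m + 1) H) : IsReduced c C τ m (schur H) :=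
  h.2.2.2.2.2

/-- **Monotonicity in the constants**: a `(c, C, τ)`-reduced family is `(c', C', τ')`-reduced for
`c ≤ c'`, `C ≤ C'`, `τ ≤ τ'` (all comparisons are against positive pivots, resp. non-negative
Schur pivots when the strict inequality already holds). [folklore] -/
theorem IsReduced.mono {c C τ c' C' τ' : ℝ} (hc : c ≤ c') (hC : C ≤ C') (hτ : τ ≤ τ') :
    ∀ {m : ℕ} {H : ι → Matrix (Fin m) (Fin m) ℂ}, IsReduced c C τ m H → IsReduced c' C' τ' m H
  | 0, _, _ => trivial
  | m + 1, H, h => by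
    obtain ⟨hh, hpos, hcross, hcol, hratio, hsch⟩ := h
    refine ⟨hh, hpos, fun w w' => ?_, fun w j => ?_, fun w j hj => ?_, hsch.mono hc hC hτ⟩
    · exact (hcross w w').trans_le (mul_le_mul_of_nonneg_right hC (hpos w').le)
    · exact (hcol w j).trans_le (mul_le_mul_of_nonneg_right hc (hpos w).le)
    · have h₁ := hratio w j hj
      -- the Schur pivot is positive: it is the last entry of the reduced family `schur H`
      have hspos : 0 < (SiegelFamily.schur H w j j).re := by
        cases m with
        | zero => exact absurd hj (by simp)
        | succ m' =>
          have hjl : j = Fin.last m' := Fin.ext (by simp [Fin.val_last]; omega)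
          subst hjl
          exact hsch.2.1 w
      exact h₁.trans_le (mul_le_mul_of_nonneg_right hτ hspos.le)

/-! ### Families of complex matrices attached to matrices over `K ⊗ ℝ` -/

open NumberField NumberField.InfinitePlace NumberField.mixedEmbedding

variable (K : Type*) [Field K]

/-- **The family of complex matrices of a matrix over `mixedSpace K = ℝ^{r₁} × ℂ^{r₂}`**: at a real
place `w` the real matrix `(x ↦ x.1 w)` read in `ℂ`, at a complex place the complex matrix
`(x ↦ x.2 w)`.  (Borel–Jacquet's `G_∞ = ∏_{w ∣ ∞} G(K_w)` acting on `∏_w` positive forms.)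
[folklore] -/
def placeFamily {n : ℕ} (H : Matrix (Fin n) (Fin n) (mixedSpace K)) :
    InfinitePlace K → Matrix (Fin n) (Fin n) ℂ :=
  open scoped Classical in
  fun w => if hw : IsReal w then H.map fun x => ((x.1 ⟨w, hw⟩ : ℝ) : ℂ)
    else H.map fun x => x.2 ⟨w, not_isReal_iff_isComplex.mp hw⟩

variable {K}

/-- `placeFamily` at a real place. [folklore] -/
theorem placeFamily_apply_of_isReal {n : ℕ} (H : Matrix (Fin n) (Fin n) (mixedSpace K))
    {w : InfinitePlace K} (hw : IsReal w) :
    placeFamily K H w = H.map fun x => ((x.1 ⟨w, hw⟩ : ℝ) : ℂ) := by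
  simp [placeFamily, hw]

/-- `placeFamily` at a complex place. [folklore] -/
theorem placeFamily_apply_of_isComplex {n : ℕ} (H : Matrix (Fin n) (Fin n) (mixedSpace K))
    {w : InfinitePlace K} (hw : IsComplex w) :
    placeFamily K H w = H.map fun x => x.2 ⟨w, hw⟩ := by
  have hw' : ¬ IsReal w := not_isReal_iff_isComplex.mpr hw
  simp [placeFamily, hw']

/-- `placeFamily` is additive. [folklore] -/
theorem placeFamily_add {n : ℕ} (H H' : Matrix (Fin n) (Fin n) (mixedSpace K)) :
    placeFamily K (H + H') = placeFamily K H + placeFamily K H' := by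
  funext w
  by_cases hw : IsReal w
  · simp only [Pi.add_apply, placeFamily_apply_of_isReal _ hw]
    ext i j
    simp
  · have hc : IsComplex w := not_isReal_iff_isComplex.mp hw
    simp only [Pi.add_apply, placeFamily_apply_of_isComplex _ hc]
    ext i j
    simp

/-- `placeFamily` commutes with real scalars. [folklore] -/
theorem placeFamily_smul {n : ℕ} (r : ℝ) (H : Matrix (Fin n) (Fin n) (mixedSpace K)) :
    placeFamily K (r • H) = r • placeFamily K H := by
  funext w
  by_cases hw : IsReal w
  · simp only [Pi.smul_apply, placeFamily_apply_of_isReal _ hw]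
    ext i j
    simp
  · have hc : IsComplex w := not_isReal_iff_isComplex.mp hw
    simp only [Pi.smul_apply, placeFamily_apply_of_isComplex _ hc]
    ext i j
    simp [Complex.real_smul]

variable (K) in
/-- `placeFamily` as an `ℝ`-linear map. [folklore] -/
def placeFamilyₗ (n : ℕ) :
    Matrix (Fin n) (Fin n) (mixedSpace K) →ₗ[ℝ] (InfinitePlace K → Matrix (Fin n) (Fin n) ℂ) where
  toFun := placeFamily K
  map_add' := placeFamily_add
  map_smul' := placeFamily_smul

/-- The linear map `placeFamilyₗ` is `placeFamily` (definitional). [folklore] -/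
@[simp]
theorem placeFamilyₗ_apply {n : ℕ} (H : Matrix (Fin n) (Fin n) (mixedSpace K)) :
    placeFamilyₗ K n H = placeFamily K H :=
  rfl

/-- `placeFamily` is injective: a matrix over `ℝ^{r₁} × ℂ^{r₂}` is determined by its components.
[folklore] -/
theorem placeFamily_injective (n : ℕ) : Function.Injective (placeFamily K (n := n)) := by
  intro H H' h
  refine Matrix.ext fun i j => Prod.ext (funext fun w => ?_) (funext fun w => ?_)
  · -- real places
    have hw := congrFun h w.1
    rw [placeFamily_apply_of_isReal _ w.2, placeFamily_apply_of_isReal _ w.2] at hw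
    have hij := congrFun (congrFun hw i) j
    simp only [Matrix.map_apply, Complex.ofReal_inj] at hij
    exact hij
  · -- complex places
    have hw := congrFun h w.1
    rw [placeFamily_apply_of_isComplex _ w.2, placeFamily_apply_of_isComplex _ w.2] at hw
    exact congrFun (congrFun hw i) j

/-- `placeFamily` is continuous. [folklore] -/
theorem continuous_placeFamily (n : ℕ) : Continuous (placeFamily K (n := n)) := by
  refine continuous_pi fun w => ?_
  by_cases hw : IsReal w
  · have he : (fun H : Matrix (Fin n) (Fin n) (mixedSpace K) => placeFamily K H w) =
        fun H => H.map fun x => ((x.1 ⟨w, hw⟩ : ℝ) : ℂ) :=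
      funext fun H => placeFamily_apply_of_isReal H hw
    rw [he]
    exact Continuous.matrix_map continuous_id
      (Complex.continuous_ofReal.comp ((continuous_apply _).comp continuous_fst))
  · have hc : IsComplex w := not_isReal_iff_isComplex.mp hw
    have he : (fun H : Matrix (Fin n) (Fin n) (mixedSpace K) => placeFamily K H w) =
        fun H => H.map fun x => x.2 ⟨w, hc⟩ :=
      funext fun H => placeFamily_apply_of_isComplex H hc
    rw [he]
    exact Continuous.matrix_map continuous_id ((continuous_apply _).comp continuous_snd)

end SiegelFamily

end Literature.NumberTheory.Automorphic
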